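import Mathlib
import Literature.Computability.AlgebraicComplexity.RealTauConjectureDepthFour
import Literature.Computability.AlgebraicComplexity.DeterminantalIdealComplexity
import HarnessLib

/-!
# Universe descent for Andrews 2022, Theorem 3

Topic `Literature/Computability/AlgebraicComplexity`. The named fact `Andrews2022_thm3`
(`DeterminantalIdealComplexity.lean`) quantifies over fields `F : Type u` in an arbitrary universe,
while its proof (`DeterminantalIdealComplexityProofs.lean`) goes through the tree's
`AndrewsForbes2022_prop_3_5`, stated for `F : Type` only. This file proves the (purely formal)
reduction `Andrews2022_thm3.{0} → Andrews2022_thm3.{u}`: the statement for a given nonzero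
`f ∈ I^det_{n,m,r} ⊆ F[X]` only involves a finitely generated — hence countable — subfield
`K₀ ⊆ F` containing the coefficients of `f`, of a certificate `f = Σ hᵢ · (minor)ᵢ` of ideal
membership, and the constants of an optimal circuit for `f`; a countable field is isomorphic to
one in `Type 0` (`Shrink`), the complexity of `f` does not increase in passing to `K₀`
(the optimal circuit has its constants in `K₀`), and the algebraic border rank of `⟨t,t,t⟩` does
not increase under extension of scalars `K₀ → F` (approximate decompositions map along ring
homomorphisms).

## Content

* `ArithCircuit.consts`, `ArithCircuit.mapConsts`, `ArithCircuit.map_mapConsts_eq_self` — the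
  constants of a circuit and its restriction to a subfield containing them.
* `map_mem_detIdeal` — determinantal ideals are preserved by change of scalars.
* `algBorderRank_matMulTensor_le_of_ringHom` — `bR_{K'}(⟨a,b,c⟩) ≤ bR_K(⟨a,b,c⟩)` along any
  `K →+* K'`.
* `Andrews2022_thm3_descent : Andrews2022_thm3.{0} → Andrews2022_thm3.{u}`.

## References

* [Andrews2022] R. Andrews, FOCS 2022, arXiv:2208.01078, Thm. 3 (the statement being transported).
* [Burgisser2000] P. Bürgisser, 2000, §4.1 (extension of scalars in straight-line programs).
* [Blaser2013] M. Bläser, 2013, Def. 6.1 (border rank over `K[ε]`).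
-/

noncomputable section

open MvPolynomial

namespace Literature.Computability.AlgebraicComplexity

universe u v w u₁ u₂

/-! ### Constants of a circuit; restriction of scalars -/

namespace ArithCircuit

variable {k : Type u} {k' : Type w} {σ : Type v}

/-- The constants occurring in an operand. [cite: Burgisser2000, §4.1] -/
def Operand.consts : Operand k σ → List k
  | .const c => [c]
  | _ => []

/-- The constants and sum coefficients occurring in a gate. [cite: Burgisser2000, §4.1] -/
def Gate.consts : Gate k σ → List k
  | .sum args => args.map Prod.fst ++ args.flatMap fun a => a.2.consts
  | .prod args => args.flatMap Operand.consts

/-- All constants and coefficients occurring in a circuit (a finite list). [cite: Burgisser2000, §4.1] -/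
def consts (P : ArithCircuit k σ) : List k :=
  (P.gates.flatMap Gate.consts) ++ P.output.consts

/-- Change of constants along a plain function (used to RESTRICT scalars to a subfield through a
retraction; cf. `ArithCircuit.map` for ring homomorphisms). [cite: Burgisser2000, §4.1] -/
def mapConsts (ρ : k → k') (P : ArithCircuit k σ) : ArithCircuit k' σ where
  gates := P.gates.map (Gate.map ρ)
  output := P.output.map ρ

/-- `mapConsts` does not change the size. [cite: Burgisser2000, §4.1] -/
@[simp] theorem size_mapConsts (ρ : k → k') (P : ArithCircuit k σ) :
    (P.mapConsts ρ).size = P.size := by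
  simp [mapConsts, size]

/-- `mapConsts` preserves fan-in two. [cite: Burgisser2000, §4.1] -/
theorem IsFanInTwo.mapConsts {P : ArithCircuit k σ} (hP : P.IsFanInTwo) (ρ : k → k') :
    (P.mapConsts ρ).IsFanInTwo := by
  intro g hg
  simp only [ArithCircuit.mapConsts, List.mem_map] at hg
  obtain ⟨g', hg', rfl⟩ := hg
  rw [Gate.fanIn_map]
  exact hP g' hg'

/-- An operand is recovered from its image under `ρ` by `ψ` if `ψ ∘ ρ` fixes its constants. [folklore] -/
theorem Operand.map_map_eq_self {ρ : k → k'} {ψ : k' → k} (u : Operand k σ)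
    (h : ∀ c ∈ u.consts, ψ (ρ c) = c) : (u.map ρ).map ψ = u := by
  cases u with
  | var i => rfl
  | const c => exact congrArg Operand.const (h c (by simp [Operand.consts]))
  | gate j => rfl

/-- A gate is recovered from its image under `ρ` by `ψ` if `ψ ∘ ρ` fixes its constants. [folklore] -/
theorem Gate.map_map_eq_self {ρ : k → k'} {ψ : k' → k} (g : Gate k σ)
    (h : ∀ c ∈ g.consts, ψ (ρ c) = c) : (g.map ρ).map ψ = g := by
  cases g with
  | sum args =>
    simp only [Gate.map, List.map_map]
    congr 1
    conv_rhs => rw [← List.map_id args]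
    refine List.map_congr_left fun a ha => ?_
    simp only [Function.comp_apply, id_eq]
    refine Prod.ext (h a.1 ?_) (Operand.map_map_eq_self a.2 fun c hc => h c ?_)
    · simp only [Gate.consts, List.mem_append, List.mem_map, List.mem_flatMap]
      exact Or.inl ⟨a, ha, rfl⟩
    · simp only [Gate.consts, List.mem_append, List.mem_map, List.mem_flatMap]
      exact Or.inr ⟨a, ha, hc⟩
  | prod args =>
    simp only [Gate.map, List.map_map]
    congr 1
    conv_rhs => rw [← List.map_id args]
    refine List.map_congr_left fun u hu => ?_
    simp only [Function.comp_apply, id_eq]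
    refine Operand.map_map_eq_self u fun c hc => h c ?_
    simp only [Gate.consts, List.mem_flatMap]
    exact ⟨u, hu, hc⟩

/-- **Restriction of scalars**: if the ring homomorphism `ψ : k' → k` composed with `ρ : k → k'`
fixes every constant of `P` (e.g. `ψ` a subfield inclusion and `ρ` a retraction onto it), then `P`
is the change of scalars along `ψ` of the circuit `P.mapConsts ρ` over `k'`. [cite: Burgisser2000, §4.1] -/
theorem map_mapConsts_eq_self [CommSemiring k] [CommSemiring k'] (ρ : k → k') (ψ : k' →+* k)
    (P : ArithCircuit k σ) (h : ∀ c ∈ P.consts, ψ (ρ c) = c) : (P.mapConsts ρ).map ψ = P := by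
  obtain ⟨gates, output⟩ := P
  simp only [mapConsts, ArithCircuit.map, List.map_map, ArithCircuit.mk.injEq]
  constructor
  · conv_rhs => rw [← List.map_id gates]
    refine List.map_congr_left fun g hg => ?_
    simp only [Function.comp_apply, id_eq]
    refine Gate.map_map_eq_self g fun c hc => h c ?_
    simp only [consts, List.mem_append, List.mem_flatMap]
    exact Or.inl ⟨g, hg, hc⟩
  · refine Operand.map_map_eq_self output fun c hc => h c ?_
    simp only [consts, List.mem_append]
    exact Or.inr hc

end ArithCircuit

/-! ### Change of scalars in determinantal ideals and in border rank -/

/-- Determinantal ideals are preserved under change of scalars (the minors have integer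
coefficients). [folklore] -/
theorem map_mem_detIdeal {K : Type u₁} {K' : Type u₂} [Field K] [Field K'] (ψ : K →+* K')
    {n m r : ℕ} {g : MvPolynomial (Fin n × Fin m) K} (hg : g ∈ detIdeal K n m r) :
    MvPolynomial.map ψ g ∈ detIdeal K' n m r := by
  have hle : Ideal.map (MvPolynomial.map ψ) (detIdeal K n m r) ≤ detIdeal K' n m r := by
    rw [detIdeal, Ideal.map_span, Ideal.span_le]
    rintro p ⟨q, ⟨ρ, γ, rfl⟩, rfl⟩
    refine Ideal.subset_span ⟨ρ, γ, ?_⟩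
    rw [RingHom.map_det, RingHom.mapMatrix_apply]
    congr 1
    ext i j
    simp [Matrix.mvPolynomialX_apply]
  exact hle (Ideal.mem_map_of_mem _ hg)

/-- Approximate decompositions map along ring homomorphisms: `bR_{K'}(⟨a,b,c⟩) ≤ bR_K(⟨a,b,c⟩)`
for any `ψ : K →+* K'` (the matrix multiplication tensor has entries `0, 1`).
[cite: Blaser2013, Def. 6.1] -/
theorem algBorderRank_matMulTensor_le_of_ringHom {K : Type u₁} {K' : Type u₂} [Field K] [Field K']
    (ψ : K →+* K') (a b c : ℕ) :
    algBorderRank (matMulTensor K' a b c) ≤ algBorderRank (matMulTensor K a b c) := by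
  classical
  have key : ∀ h : ℕ, approxRank h (matMulTensor K' a b c) ≤ approxRank h (matMulTensor K a b c) := by
    intro h
    have hne : {r : ℕ | ∃ (u : Fin r → Fin a × Fin c → Polynomial K)
        (v : Fin r → Fin a × Fin b → Polynomial K) (w : Fin r → Fin b × Fin c → Polynomial K),
        IsApproxDecomposition h (matMulTensor K a b c) u v w}.Nonempty := by
      obtain ⟨r, u, v, w, huvw⟩ := exists_isApproxDecomposition h (matMulTensor K a b c)
      exact ⟨r, u, v, w, huvw⟩
    obtain ⟨u, v, w, huvw⟩ := Nat.sInf_mem hne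
    unfold approxRank
    refine approxRank_le_of_isApproxDecomposition (u := fun ρ i => (u ρ i).map ψ)
      (v := fun ρ i => (v ρ i).map ψ) (w := fun ρ i => (w ρ i).map ψ) ?_
    intro x y z j hj
    have hsum : (∑ ρ, (u ρ x).map ψ * (v ρ y).map ψ * (w ρ z).map ψ) =
        (∑ ρ, u ρ x * v ρ y * w ρ z).map ψ := by
      rw [Polynomial.map_sum]
      simp [Polynomial.map_mul]
    rw [hsum, Polynomial.coeff_map, huvw x y z j hj]
    simp only [matMulTensor, apply_ite ψ, map_one, map_zero]
  exact le_ciInf fun h => (ciInf_le (OrderBot.bddBelow _) h).trans (key h)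

/-! ### Countable subfields and `Type 0` models -/

/-- A finite subset of a field lies in a countable subfield. [folklore] -/
theorem exists_countable_subfield {F : Type u} [Field F] (A : Finset F) :
    ∃ K₀ : Subfield F, (↑A : Set F) ⊆ K₀ ∧ Countable K₀ := by
  refine ⟨Subfield.closure A, Subfield.subset_closure, ?_⟩
  rw [← Cardinal.mk_le_aleph0_iff]
  refine (Subfield.cardinalMk_closure_le_max _).trans (max_le ?_ le_rfl)
  exact Cardinal.mk_le_aleph0_iff.2 (Finite.to_countable)

/-- A semiring admitting a homomorphism to a characteristic-zero semiring has characteristic zero.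
[folklore] -/
theorem charZero_of_ringHom {R : Type u₁} {S : Type u₂} [NonAssocSemiring R]
    [NonAssocSemiring S] (φ : R →+* S) [CharZero S] : CharZero R :=
  ⟨fun a b h => Nat.cast_injective (R := S) (by rw [← map_natCast φ a, ← map_natCast φ b, h])⟩

/-- A polynomial all of whose coefficients lie in a subfield comes from that subfield. [folklore] -/
theorem exists_eq_map_of_coeff_mem {F : Type u} [Field F] (K₀ : Subfield F) {σ : Type v}
    (p : MvPolynomial σ F) (h : ∀ e ∈ p.support, coeff e p ∈ K₀) :
    ∃ p₀ : MvPolynomial σ K₀, MvPolynomial.map K₀.subtype p₀ = p := by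
  classical
  refine ⟨∑ e ∈ p.support.attach, monomial e.1 (⟨coeff e.1 p, h e.1 e.2⟩ : K₀), ?_⟩
  rw [map_sum]
  simp only [map_monomial, Subfield.coe_subtype]
  rw [Finset.sum_attach p.support fun e => monomial e (coeff e p)]
  exact p.support_sum_monomial_coeff

/-! ### The descent -/

/-- **Universe descent for Andrews' Theorem 3**: the statement for fields in `Type 0` implies it
for fields in every universe. For a nonzero `f ∈ I^det_{n,m,r} ⊆ F[X]`, take a countable subfield
`K₀ ⊆ F` containing the coefficients of `f`, of a certificate `f = Σᵢ hᵢ · (minor)ᵢ`, and the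
constants of an optimal circuit for `f`; then `f = f₀ ⊗ F` with `0 ≠ f₀ ∈ I^det_{n,m,r}(K₀)`,
`complexity_{K₀}(f₀) ≤ complexity_F(f)`, `K₀ ≅ K₁ : Type` (countable), and
`bR_F(⟨t,t,t⟩) ≤ bR_{K₁}(⟨t,t,t⟩) ≤ 6 · complexity_{K₁}(f₁) ≤ 6 · complexity_F(f)`.
[cite: Andrews2022, Thm. 3] -/
theorem Andrews2022_thm3_descent (h : Andrews2022_thm3.{0}) : Andrews2022_thm3.{u} := by
  intro F _ _ n m r f hf hf0
  classical
  -- an optimal circuit and a certificate of ideal membership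
  obtain ⟨P, hP2, hPf, hsize⟩ := ArithCircuit.exists_computes_size_eq_complexity f
  obtain ⟨N, coef, gen, hsum⟩ := Submodule.mem_span_set'.1 hf
  choose ρ γ hργ using fun i => (gen i).2
  -- a countable subfield containing all the constants involved
  obtain ⟨K₀, hAK, hK₀⟩ := exists_countable_subfield
    (P.consts.toFinset ∪ Finset.univ.biUnion fun i => ((coef i).support.image fun e => coeff e (coef i)))
  have hPc : ∀ c ∈ P.consts, c ∈ K₀ := fun c hc =>
    hAK (Finset.mem_union_left _ (List.mem_toFinset.2 hc))
  have hcoefK : ∀ i, ∀ e ∈ (coef i).support, coeff e (coef i) ∈ K₀ := fun i e he =>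
    hAK (Finset.mem_union_right _ (Finset.mem_biUnion.2 ⟨i, Finset.mem_univ _,
      Finset.mem_image.2 ⟨e, he, rfl⟩⟩))
  choose coef₀ hcoef₀ using fun i => exists_eq_map_of_coeff_mem K₀ (coef i) (hcoefK i)
  -- `f = f₀ ⊗ F` with `f₀ ∈ I^det(K₀)` nonzero
  set ι : K₀ →+* F := K₀.subtype with hι
  have hιinj : Function.Injective ι := Subtype.val_injective
  set f₀ : MvPolynomial (Fin n × Fin m) K₀ := ∑ i, coef₀ i *
    ((Matrix.mvPolynomialX (Fin n) (Fin m) K₀).submatrix (ρ i) (γ i)).det with hf₀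
  have hgen : ∀ i, MvPolynomial.map ι
      ((Matrix.mvPolynomialX (Fin n) (Fin m) K₀).submatrix (ρ i) (γ i)).det = (gen i : _) := by
    intro i
    rw [hργ i, RingHom.map_det, RingHom.mapMatrix_apply]
    congr 1
    ext x y
    simp [Matrix.mvPolynomialX_apply]
  have hf₀map : MvPolynomial.map ι f₀ = f := by
    rw [hf₀, map_sum, ← hsum]
    refine Finset.sum_congr rfl fun i _ => ?_
    rw [map_mul, hcoef₀, hgen, smul_eq_mul]
  have hf₀mem : f₀ ∈ detIdeal K₀ n m r :=
    Ideal.sum_mem _ fun i _ => Ideal.mul_mem_left _ _ (Ideal.subset_span ⟨ρ i, γ i, rfl⟩)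
  have hf₀ne : f₀ ≠ 0 := fun h0 => hf0 (by rw [← hf₀map, h0, map_zero])
  -- the optimal circuit restricts to `K₀`
  set ρK : F → K₀ := fun x => if hx : x ∈ K₀ then ⟨x, hx⟩ else 0 with hρK
  set P₀ := P.mapConsts ρK with hP₀
  have hP₀map : P₀.map ι = P :=
    ArithCircuit.map_mapConsts_eq_self ρK ι P fun c hc => by simp [hρK, hι, hPc c hc]
  have hP₀f : P₀.Computes f₀ := by
    have hev := ArithCircuit.eval_map_apply ι P₀
    rw [hP₀map] at hev
    unfold ArithCircuit.Computes at hPf ⊢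
    apply MvPolynomial.map_injective ι hιinj
    rw [← hev, hf₀map, hPf]
  -- a model of `K₀` in `Type 0`
  haveI : Countable K₀ := hK₀
  haveI : Small.{0} K₀ := Countable.toSmall _
  set e : Shrink.{0} K₀ ≃+* K₀ := Shrink.ringEquiv K₀ with he
  haveI : CharZero (Shrink.{0} K₀) := charZero_of_ringHom (ι.comp e.toRingHom)
  set f₁ : MvPolynomial (Fin n × Fin m) (Shrink.{0} K₀) := MvPolynomial.map e.symm.toRingHom f₀
    with hf₁
  have hf₁mem : f₁ ∈ detIdeal (Shrink.{0} K₀) n m r := map_mem_detIdeal _ hf₀mem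
  have hf₁ne : f₁ ≠ 0 := fun h0 => hf₀ne
    (MvPolynomial.map_injective e.symm.toRingHom e.symm.injective (by rw [← hf₁, h0, map_zero]))
  have hmain := h (Shrink.{0} K₀) n m r f₁ hf₁mem hf₁ne
  -- complexity does not increase
  have hc1 : complexity f₁ ≤ complexity f := by
    have hcomp : (P₀.map e.symm.toRingHom).Computes f₁ := hP₀f.map _
    calc complexity f₁ ≤ (P₀.map e.symm.toRingHom).size :=
          ArithCircuit.complexity_le_size ((hP2.mapConsts ρK).map _) hcomp
      _ = P.size := by rw [ArithCircuit.size_map, hP₀, ArithCircuit.size_mapConsts]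
      _ = complexity f := hsize
  -- border rank does not increase under `K₁ → F`
  have hbr := algBorderRank_matMulTensor_le_of_ringHom (ι.comp e.toRingHom) (r / 4) (r / 4) (r / 4)
  calc algBorderRank (matMulTensor F (r / 4) (r / 4) (r / 4))
      ≤ algBorderRank (matMulTensor (Shrink.{0} K₀) (r / 4) (r / 4) (r / 4)) := hbr
    _ ≤ 6 * complexity f₁ := hmain
    _ ≤ 6 * complexity f := Nat.mul_le_mul_left 6 hc1

end Literature.Computability.AlgebraicComplexity
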